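import Summits.SmoothPoincare4.SmoothPoincare4.Theses.EntropyRung
import Summits.SmoothPoincare4.SmoothPoincare4.Theorems.EntropyRungSubcylindricalRecognitionOfBamler
import Summits.SmoothPoincare4.SmoothPoincare4.Theorems.EntropyRungSubcylindricalRecognitionCompactModelRecognition
import Literature.Geometry.Riemannian.BamlerTangentFlowAtInfinity
import Literature.Geometry.Riemannian.RicciFlowMaximal
import Literature.Geometry.Riemannian.PerelmanEntropy
import Literature.Topology.FourManifolds.HomotopyS4CompactProofs
import HarnessLib

/-!
# Strategist sketch — crux stmt-SmoothPoincare4-10869 `EntropyRung.SubcylindricalRecognition`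
(planner-cstrat-stmt-SmoothPoincare4-10869-s1-0, 2026-08-17)

§D  DECOMPOSITION.  `ShrinkerEmerges` — the route-vocabulary SHADOW of the named fact N1
    `bamler_orbifoldTangentFlowAtInfinity_four`: exactly what the rung consumes from Bamler 2020a–c, stated over the
    route file's own vocabulary (no flows, no μ, no metric flows), SPC4-free (no `≃ₕ S⁴`; closed CONNECTED `M`).
    * `shrinkerEmerges_of_bamler : N1 → ShrinkerEmerges` (landed chain: `blowupSequence` + `blowdown_of`);
    * `subcylindricalRecognition_of_shrinkerEmerges :
         ShrinkerEmerges → NoncompactShrinkerGap → CompactShrinkerGap → SubcylindricalRecognition` (sorry-free, fact-free):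
      the typed split RUNG ⇐ {ShrinkerEmerges, #2, #4}.
§T  TRANSFER target `AncientCylinderLiouville` (the 3-d κ-solution step transported: Liouville at the cylinder threshold).
§S  STRENGTHEN target `FloorForcesTypeI` (floor above the cylinder ⇒ Type I at the first singular time).
Nothing here is a route item; the file only certifies that the census signatures elaborate.
-/

noncomputable section

open scoped Manifold ContDiff Topology ENNReal NNReal ContinuousMap
open Set MeasureTheory Filter
open Literature.Geometry.Lorentzian Literature.Geometry.Riemannian

namespace Summit.SmoothPoincare4.SmoothPoincare4.Theses.EntropyRung.Strategist

/-! ## §D The shadow of N1 in route vocabulary -/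

/-- **ShrinkerEmerges** (support-grade shadow of Bamler's tangent flow at `-∞`): on a closed connected smooth
4-manifold, a Riemannian metric with `R > 0` and Perelman entropy floor `μ(g,τ) ≥ ν_cyl + δ` (all `τ > 0`,
unfolded exactly as in the crux) gives rise to a complete connected non-flat normalised gradient shrinking Ricci
soliton `(S, g_S, f_S)` — `Ric + Hess f = g/2`, `R + |∇f|² = f` — of Gaussian mass `∫ e^{-f} dV > 32π²√π e^{-3/2}`
(density `> Θ(S³×ℝ)`), which, if compact, immerses injectively and smoothly into `M`. (It is the blow-down at `-∞`,
in Bamler's sense, of the blow-up sequence of the Ricci flow of `g` at its first singular time; cone points are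
excluded on the compact approximants by the entropy floor.) -/
def ShrinkerEmerges : Prop :=
  ∀ (M : Type) [TopologicalSpace M] [T2Space M] [SecondCountableTopology M]
    [ChartedSpace (EuclideanSpace ℝ (Fin 4)) M] [IsManifold (𝓡 4) ∞ M] [CompactSpace M] [ConnectedSpace M]
    [T3Space M] [MeasurableSpace M] [BorelSpace M]
    (g : PseudoRiemannianMetric (𝓡 4) ∞ (EuclideanSpace ℝ (Fin 4)) (TangentSpace (𝓡 4) : M → Type _))
    [g.HasLeviCivita] (hg : g.IsRiemannian),
    (∀ x : M, 0 < g.scalarCurvature x) →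
    (∃ δ : ℝ, 0 < δ ∧ ∀ τ : ℝ, 0 < τ → ∀ f : M → ℝ, ContMDiff (𝓡 4) 𝓘(ℝ, ℝ) ∞ f →
      ∫ x, (4 * Real.pi * τ) ^ (-(4 : ℝ) / 2) * Real.exp (-f x)
        ∂(riemannianMeasure (g.toContMDiffRiemannianMetric hg)) = 1 →
      Real.log 2 + Real.log Real.pi / 2 - 3 / 2 + δ ≤
        ∫ x, (τ * (g.scalarCurvature x + g.gradSq f x) + f x - 4) *
          ((4 * Real.pi * τ) ^ (-(4 : ℝ) / 2) * Real.exp (-f x))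
          ∂(riemannianMeasure (g.toContMDiffRiemannianMetric hg))) →
    ∃ (S : Type) (_ : TopologicalSpace S) (_ : T2Space S) (_ : SecondCountableTopology S)
      (_ : ChartedSpace (EuclideanSpace ℝ (Fin 4)) S) (_ : IsManifold (𝓡 4) ∞ S) (_ : ConnectedSpace S)
      (_ : T3Space S) (_ : MeasurableSpace S) (_ : BorelSpace S)
      (gS : PseudoRiemannianMetric (𝓡 4) ∞ (EuclideanSpace ℝ (Fin 4)) (TangentSpace (𝓡 4) : S → Type _))
      (_ : gS.HasLeviCivita) (fS : S → ℝ) (hS : gS.IsRiemannian),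
      (∀ (x : S) (r : NNReal), IsCompact {y : S | gS.edist hS x y ≤ r}) ∧
      ContMDiff (𝓡 4) 𝓘(ℝ, ℝ) ∞ fS ∧
      (∀ (x : S) (X Y : TangentSpace (𝓡 4) x),
        gS.ricci x X Y + gS.hessian fS x X Y = (1 / 2 : ℝ) * gS.val x X Y) ∧
      (∀ x : S, gS.scalarCurvature x + gS.gradSq fS x = fS x) ∧
      (∃ x : S, gS.scalarCurvature x ≠ 0) ∧
      ENNReal.ofReal (32 * Real.pi ^ 2 * Real.sqrt Real.pi * Real.exp (-(3 : ℝ) / 2)) <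
        ∫⁻ x, ENNReal.ofReal (Real.exp (-fS x))
          ∂(riemannianMeasure (gS.toContMDiffRiemannianMetric hS)) ∧
      (CompactSpace S → ∃ φ : S → M, ContMDiff (𝓡 4) (𝓡 4) ∞ φ ∧ Function.Injective φ ∧
        ∀ x : S, Function.Injective (mfderiv (𝓡 4) (𝓡 4) φ x))

/-- `N1 → ShrinkerEmerges`: the landed blow-up chain (`RecognitionOfShrinkerGaps.blowupSequence`, fact-free since
F1/F2 are theorems) followed by the landed blow-down `RecognitionOfShrinkerGaps.blowdown_of` run on N1.
[cite: Bamler2020Structure, §2.7 Thm 2.40; §2.10 Thm 2.46] -/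
theorem shrinkerEmerges_of_bamler (hN1 : bamler_orbifoldTangentFlowAtInfinity_four) : ShrinkerEmerges := by
  intro M _ _ _ _ _ _ _ _ _ _ g _ hg hR hν
  obtain ⟨κ, δ', c, _hκ, hδ', hc, A, gk, covk, xk, hA, hflow, hRiem, hcurv, hpt, _hnc, hfloor⟩ :=
    _root_.Summit.SmoothPoincare4.SmoothPoincare4.Theorems.RecognitionOfShrinkerGaps.blowupSequence M g hg hR hν
  exact _root_.Summit.SmoothPoincare4.SmoothPoincare4.Theorems.RecognitionOfShrinkerGaps.blowdown_of hN1 M A gk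
    covk xk δ' c hδ' hc hA hflow hRiem hcurv hpt hfloor

/-- **The split glue, sorry-free and fact-free**: `ShrinkerEmerges → NoncompactShrinkerGap → CompactShrinkerGap →
SubcylindricalRecognition`. A non-compact emerging shrinker contradicts the non-compact gap (mass `>` versus `≤`);
a compact one immerses injectively into the connected `M`, hence is diffeomorphic to `M ≃ₕ S⁴`
(`stub_compactModelRecognition`, landed p72507), so it is a dense compact shrinker on a homotopy 4-sphere and the
compact gap returns its diffeomorphism to `S⁴`. [folklore] -/
theorem subcylindricalRecognition_of_shrinkerEmerges (hE : ShrinkerEmerges)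
    (h₂ : NoncompactShrinkerGap) (h₄ : CompactShrinkerGap) : SubcylindricalRecognition := by
  intro M _ _ _ _ _ _ _ _ _ e g _ hg hR hν
  haveI : PathConnectedSpace (Metric.sphere (0 : EuclideanSpace ℝ (Fin 5)) 1) :=
    Literature.Topology.FourManifolds.pathConnectedSpace_sphere_four
  haveI : PathConnectedSpace M :=
    Literature.Topology.FourManifolds.pathConnectedSpace_of_homotopyEquiv e
  obtain ⟨S, _, _, _, _, _, _, _, _, _, gS, _, fS, hS, hScomplete, hfS, hsol, hnorm, hSnonflat, hdens,
      hScouple⟩ := hE M g hg hR hν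
  by_cases hSc : CompactSpace S
  · obtain ⟨φ, hφ, hφinj, hφimm⟩ := hScouple hSc
    obtain ⟨eSM⟩ :=
      _root_.Summit.SmoothPoincare4.SmoothPoincare4.Theorems.SubcylindricalRecognition.AncientSphereRigidity.stub_compactModelRecognition
        S M φ hφ hφinj hφimm
    have eS4 : S ≃ₕ Metric.sphere (0 : EuclideanSpace ℝ (Fin 5)) 1 :=
      eSM.toHomeomorph.toHomotopyEquiv.trans e
    obtain ⟨eS⟩ := h₄ S eS4 gS fS hS hfS hsol hnorm hdens
    exact ⟨eSM.symm.trans eS⟩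
  · haveI : NoncompactSpace S := not_compactSpace_iff.mp hSc
    have hle := h₂ S gS fS hS hScomplete hfS hsol hnorm hSnonflat
    exact absurd hdens (not_lt.mpr hle)

/-- The decomposition closes the crux today modulo N1 alone (cross-check). [folklore] -/
theorem subcylindricalRecognition_of_bamler' (hN1 : bamler_orbifoldTangentFlowAtInfinity_four)
    (h₂ : NoncompactShrinkerGap) (h₄ : CompactShrinkerGap) : SubcylindricalRecognition :=
  subcylindricalRecognition_of_shrinkerEmerges (shrinkerEmerges_of_bamler hN1) h₂ h₄

/-! ## §T Transfer target — Liouville at the cylinder threshold (Conjecture L)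

The 3-d κ-solution step (Perelman I, Prop. 11.2) transported to dimension 4 with the curvature sign replaced by the
entropy floor: the Hamilton limit of the blow-up sequence is an ancient complete flow with `|Rm| ≤ 1`, a non-flat
point and the floor at all scales; the conjecture says it lives on `S⁴`. Its only known proof is Bamler's
blow-down at `-∞` plus the two density gaps — i.e. N1 again (census §Transfer). -/

/-- **AncientCylinderLiouville** (Conjecture L; not filed): a complete connected ancient 4-dimensional Ricci flow
`(g(t))_{t ≤ 0}` of Riemannian metrics with `|Rm| ≤ 1`, a non-flat point at time `0`, and Perelman's floor
`μ(g(t), τ) ≥ ν_cyl + δ` for all `t ≤ 0`, `τ > 0`, `δ > 0`, lives on a manifold diffeomorphic to `S⁴`. -/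
def AncientCylinderLiouville : Prop :=
  ∀ (N : Type) [TopologicalSpace N] [T2Space N] [SecondCountableTopology N]
    [ChartedSpace (EuclideanSpace ℝ (Fin 4)) N] [IsManifold (𝓡 4) ∞ N] [ConnectedSpace N]
    [T3Space N] [MeasurableSpace N] [BorelSpace N]
    (g : ℝ → PseudoRiemannianMetric (𝓡 4) ∞ (EuclideanSpace ℝ (Fin 4)) (TangentSpace (𝓡 4) : N → Type _))
    (cov : ℝ → CovariantDerivative (𝓡 4) (EuclideanSpace ℝ (Fin 4)) (TangentSpace (𝓡 4) : N → Type _))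
    (x₀ : N) (δ c : ℝ), 0 < δ → 0 < c →
    IsRicciFlow g cov (Set.Iic 0) →
    (∀ t, t ≤ 0 → ∃ ht : (g t).IsRiemannian, ∀ (x : N) (r : NNReal), IsCompact {y : N | (g t).edist ht x y ≤ r}) →
    (∀ t, t ≤ 0 → CurvatureBoundedBy (g t) (cov t) 1) →
    (∃ X Y Z W : TangentSpace (𝓡 4) x₀,
      (g 0).val x₀ X X ≤ 1 ∧ (g 0).val x₀ Y Y ≤ 1 ∧ (g 0).val x₀ Z Z ≤ 1 ∧ (g 0).val x₀ W W ≤ 1 ∧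
      c ≤ |(g 0).curvatureForm (cov 0) x₀ X Y Z W|) →
    (∀ t, t ≤ 0 → ∀ τ : ℝ, 0 < τ →
      ((Real.log 2 + Real.log Real.pi / 2 - 3 / 2 + δ : ℝ) : EReal) ≤ (g t).muEntropy (cov t) τ) →
    Nonempty (N ≃ₘ⟮𝓡 4, 𝓡 4⟯ (Metric.sphere (0 : EuclideanSpace ℝ (Fin 5)) 1))

/-! ## §S Strengthen target — the floor forces Type I -/

/-- **FloorForcesTypeI** (S⁺; not filed): on a closed connected 4-manifold, a maximal Ricci flow with `R > 0`
initially and Perelman's floor `μ(g(t), τ) ≥ ν_cyl + δ` along the flow is Type I at its singular time `T`: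
`|Rm|(·, t) ≤ C/(T - t)`. With Enders–Müller–Topping 2011 Thm 1.4 / Naber 2010 this would give smooth non-flat
shrinker blow-ups Bamler-free; but every Type-II exclusion in print goes through a blow-down (census §Strengthen). -/
def FloorForcesTypeI : Prop :=
  ∀ (M : Type) [TopologicalSpace M] [T2Space M] [SecondCountableTopology M]
    [ChartedSpace (EuclideanSpace ℝ (Fin 4)) M] [IsManifold (𝓡 4) ∞ M] [CompactSpace M] [ConnectedSpace M]
    [T3Space M] [MeasurableSpace M] [BorelSpace M]
    (g : ℝ → PseudoRiemannianMetric (𝓡 4) ∞ (EuclideanSpace ℝ (Fin 4)) (TangentSpace (𝓡 4) : M → Type _))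
    (cov : ℝ → CovariantDerivative (𝓡 4) (EuclideanSpace ℝ (Fin 4)) (TangentSpace (𝓡 4) : M → Type _))
    (T δ : ℝ), 0 < δ →
    IsMaximalRicciFlow g cov T →
    (∀ x : M, 0 < (g 0).scalarCurvatureWith (cov 0) x) →
    (∀ C : ℝ, ∃ t₀ ∈ Set.Ico 0 T, ∀ t ∈ Set.Ico t₀ T, ¬ CurvatureBoundedBy (g t) (cov t) C) →
    (∀ t ∈ Set.Ico 0 T, ∀ τ : ℝ, 0 < τ →
      ((Real.log 2 + Real.log Real.pi / 2 - 3 / 2 + δ : ℝ) : EReal) ≤ (g t).muEntropy (cov t) τ) →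
    ∃ C : ℝ, ∀ t ∈ Set.Ico 0 T, CurvatureBoundedBy (g t) (cov t) (C / (T - t))

end Summit.SmoothPoincare4.SmoothPoincare4.Theses.EntropyRung.Strategist

end
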